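import Summits.BirchSwinnertonDyer.BirchSwinnertonDyer.Theorems.ErratumRoadFiveShimuraKolyvaginOrderBoundInertOfCertificates
import Summits.BirchSwinnertonDyer.BirchSwinnertonDyer.Theorems.ErratumRoadFiveRamNoErratumDataRung5015b1
import HarnessLib

/-!
# Crux `ShimuraKolyvaginOrderBoundInertFromFive` (item stmt-BirchSwinnertonDyer-19718, route `ErratumRoadFive` rev 18,
# `5 ≤ p ∣ N⁻`): the BC5 CERTIFICATE-ROW RUNG at the pair `(5015b1, 5)`, `K = ℚ(√−23)`, `S = {5, 17}`

Cell `bsd-stepL` (run/shared/lean/pub/bsd-stepL/), seat `bsd-stepL-shim-p1` g5 (the hand for 19718; D6 inert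
re-key). The crux is the `p ∣ N⁻` Shimura–Kolyvagin slice: Kolyvagin's ORDER bound
`#Ш(E/K)[p^∞] ≤ p^{2·ord_p[E(K):ℤP]}` for every `P ∈ E(K)` carrying the Cai–Shu–Tian display on `X_{N⁺,N⁻}` with
`p ∈ S` (`p` inert in `K`). Since `S ∋ p` is never empty, a rung of this crux cannot be the modular curve (as the
`S = ∅` rungs of the asides 19616 ∕ 19627 were); it is ONE pair with a CERTIFICATE (planner g25
2026-08-26T13:53:43Z: "S ∋ p never empty ⇒ rung = certificate row").

THE ROW. `E = 5015b1 = [0,0,1,−248,1503]`, `N = 5015 = 5·17·59` (rest-p2's rung curve of crux 19624: non-split at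
`5` with `v₅(Δ) = 2`, `17`, `59` split with `v = 1`, `∏c = 2`, `ρ̄₅` onto, `r = 1`, `Ш_an = 1` — all curve facts
kernel-decided in `ErratumRoadFiveRamNoErratumDataRung5015b1.lean`); `p = 5`; `d_K = −23`: `(−23/5) = (−23/17) = −1`,
`(−23/59) = +1`, so on this field the slice's binders force `S = {5, 17}` (INERT), `59` split, `(N, d_K) = 1`, and
`X = X_{59, 5·17}` is a genuine Shimura curve; `L(E^{(−23)},1) = 1.00342 ≠ 0`, so `L′(E/K,1) ≠ 0` and a displayed
non-torsion `P` EXISTS (the rung is not vacuous).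

THE CERTIFICATES (attested, NOT kernel-checked; binders of the theorems):
* (i) classical Kolyvagin at `K₁ = ℚ(√−179)` (`5, 17, 59` split): Heegner point `y_{K₁} = −2·(9,0)`,
  `E(K₁)_tors = 1`, so `5 ∤ [E(K₁):ℤy_{K₁}]` — rest-p2's kit j255090 (HOME/rest/RUNG-5015b1-CERT.md, evidence #13 on
  item 19624), re-used verbatim; ⟹ `Ш(E/ℚ)[5] = 0` (`Typed.noPTorsion_of_kolyvagin_of_not_dvd_index`, facts
  `kolyvagin`, `Kolyvagin1990_padicValNat_card_sha_le`);
* (ii) the twist `E^{(−23)}` (minimal model `[0,0,1,−131192,−18290043]`, `N = 2652935 = 5015·23²`): analytic rank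
  `0`, `L(E^{(−23)},1)/Ω = 8` (`Ш_an = 4`, `∏c = 2`, `#tors = 1`), a `5`-adic unit — this seat's kit j255672
  (PARI `ellanalyticrank` ∕ `ellbsd`, 60 digits; evidence on item 19718); ⟹ with Skinner 2016 Thm. C on the twist
  (multiplicative at the inert `5`, (ram) witness `17` ∕ `59`, `E^{(−23)}[5]` irreducible) `Ш(E^{(−23)}/ℚ)[5^∞] = 0`.
Hence `Ш(E/ℚ(√−23))[5^∞] = 0` (`card_primaryComponent_sha_baseChange_quadratic_of_odd_of_finite`) and the slice's
inequality holds at this row for every `P` for the trivial reason `1 ≤ 5^{2m}` — tool file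
`ErratumRoadFiveShimuraKolyvaginOrderBoundInertOfCertificates.lean`.

HONEST FRAMING. A rung is ONE pair and closes nothing; it does not exercise the Kolyvagin system on `X_{59,85}` —
it shows the slice's STATEMENT is correctly typed and true at a populated datum (T3). The row sits OFF the
kernel's use-locus of the slice (`5 ∤ ∏c(E)`): on the use-locus ((ram) ∧ (T2α), ¬(ram) ∧ `p ∣ ∏c`) certificate
(i) cannot come from the classical theorem (`p ∣ [E(K₁):ℤy_{K₁}]` at every classical field, Gross–Zagier V.(2.2))
— which is the raison d'être of the Shimura slice. THEOREMS ONLY; CONDITIONAL on the displayed published facts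
(`kolyvagin`, `Kolyvagin1990_padicValNat_card_sha_le`, `Skinner2016.thmC_padicValRat_bsd_rank_zero`,
`rank_eq_analyticRank_of_analyticRank_le_one`, `hasEntireLFunction_rat` — all conjuncts of the route's
`PublishedInputsFive`) and on the two attested certificates; nothing is booked; BSD is not proved by any of this.

PARTITION: X11b@p≥5 (B9 ∕ N8) × the p ∣ N⁻ slice (item 19718) at the one pair (5015b1, 5) — types-the-object-of
(a BC5 rung decl); closes: none (T7).

* `padicValInt_fiftynine_minimalDiscriminant_5015b1` — `v₅₉(Δ_min) = 1`.
* `mult_and_not_dvd_of_prime_dvd_5015` — every prime of `N` is multiplicative with `5 ∤ v_ℓ(Δ_min)`.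
* `rung_inert_5015b1_of_cert` — THE RUNG: the slice body at `W := 5015b1`, `p := 5` (literal, planner g26's
  registered style) with ONE extra binder `NumberField.discr K = −23 →` after `IsImaginaryQuadratic K →`, from the
  published facts (explicit binders) + the two certificates.
* `rung_inert_5015b1_of_items` — the form offered for registration as `stub_rung_inert_5015b1`:
  `PublishedInputsFive →` certificate binders `→` the same body (so the registered rung is closable by name —
  shim-p2's v5 pattern for 19616; the by-name alias is appended once planner g26 re-registers the skeleton).

References: [Kim2022HigherGZ] §2.1, Thm. 4.3 (the slice's printed statement); [Skinner2016PacificMC] Thm. C (§1);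
[McCallumLMS1991] §1 Theorem (Kolyvagin), p. 296; [GrossLMS1991] Prop. 2.1 (2); [JetchevSkinnerWan2017] §7.4.1–7.4.2;
[GrossZagier1986] V.(2.2); [Cremona1997] Table 1 (curve 5015b1); [SilvermanAEC2009] VII.5 Prop. 5.1.
-/

set_option autoImplicit false
-- the Theorems namespace of this sub repeats the summit name by design (D-0017 nested layout)
set_option linter.dupNamespace false

noncomputable section

open scoped Classical

open WeierstrassCurve IsDedekindDomain NumberField CongruenceSubgroup
  Literature.NumberTheory.EllipticCurves Literature.NumberTheory.EllipticCurves.ModularForms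
  Literature.NumberTheory.EllipticCurves.Rank1Residual
  Literature.NumberTheory.EllipticCurves.Rank1Residual.Typed
  Literature.NumberTheory.Automorphic
  Summit.BirchSwinnertonDyer.Rank1Residual Summit.BirchSwinnertonDyer.Rank1Residual.X11b
  Summit.BirchSwinnertonDyer.BirchSwinnertonDyer.Rank1Residual.IntModel
  Summit.BirchSwinnertonDyer.BirchSwinnertonDyer.Theses.ErratumRoadFive

namespace Summit.BirchSwinnertonDyer.BirchSwinnertonDyer.Theorems

/-! ## §1 Two more kernel-decided facts about `5015b1` -/

/-- `v₅₉(Δ_min(5015b1)) = 1` (`Δ = −5²·17·59`). [cite: Cremona1997, Table 1 (curve 5015b1)] -/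
theorem padicValInt_fiftynine_minimalDiscriminant_5015b1
    [((⟨0, 0, 1, -248, 1503⟩ : WeierstrassCurve ℤ).baseChange ℚ).IsGloballyMinimal] :
    padicValInt 59 ((⟨0, 0, 1, -248, 1503⟩ : WeierstrassCurve ℤ).baseChange ℚ).minimalDiscriminantInt = 1 := by
  haveI : Fact (Nat.Prime 59) := ⟨by norm_num⟩
  rw [minimalDiscriminantInt_baseChange_int, M5015b1_Δ]
  exact padicValInt_eq_of_dvd_of_not_dvd 59 (by decide) (by decide)

/-- **Every prime `ℓ ∣ 5015` is a multiplicative prime of `5015b1` with `5 ∤ v_ℓ(Δ_min)`** (`ℓ ∈ {5, 17, 59}`,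
`v = 2, 1, 1`): the "no Tamagawa loss" datum of the certificate-row tool at this curve, for ANY inert set `S`
the slice's binders allow. [cite: Cremona1997, Table 1 (curve 5015b1)] [cite: SilvermanAEC2009, VII.5 Prop. 5.1(b)] -/
theorem mult_and_not_dvd_of_prime_dvd_5015
    [((⟨0, 0, 1, -248, 1503⟩ : WeierstrassCurve ℤ).baseChange ℚ).IsElliptic]
    [((⟨0, 0, 1, -248, 1503⟩ : WeierstrassCurve ℤ).baseChange ℚ).IsGloballyMinimal]
    (ℓ : ℕ) (hℓ : ℓ.Prime) (hℓN : ℓ ∣ 5015) :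
    ∃ _ : Fact ℓ.Prime, Mult ((⟨0, 0, 1, -248, 1503⟩ : WeierstrassCurve ℤ).baseChange ℚ) ℓ ∧
      ¬ 5 ∣ padicValInt ℓ ((⟨0, 0, 1, -248, 1503⟩ : WeierstrassCurve ℤ).baseChange ℚ).minimalDiscriminantInt := by
  have h5015 : (5015 : ℕ) = 5 * (17 * 59) := by norm_num
  rw [h5015] at hℓN
  rcases (Nat.Prime.dvd_mul hℓ).mp hℓN with h5 | h'
  · obtain rfl : ℓ = 5 := (Nat.prime_dvd_prime_iff_eq hℓ (by norm_num)).mp h5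
    exact ⟨inferInstance, mult_five_5015b1, by rw [padicValInt_five_minimalDiscriminant_5015b1]; decide⟩
  · rcases (Nat.Prime.dvd_mul hℓ).mp h' with h17 | h59
    · obtain rfl : ℓ = 17 := (Nat.prime_dvd_prime_iff_eq hℓ (by norm_num)).mp h17
      haveI : Fact (Nat.Prime 17) := ⟨by norm_num⟩
      exact ⟨inferInstance, mult_seventeen_5015b1,
        by rw [padicValInt_seventeen_minimalDiscriminant_5015b1]; decide⟩
    · obtain rfl : ℓ = 59 := (Nat.prime_dvd_prime_iff_eq hℓ (by norm_num)).mp h59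
      haveI : Fact (Nat.Prime 59) := ⟨by norm_num⟩
      exact ⟨inferInstance, mult_fiftynine_5015b1,
        by rw [padicValInt_fiftynine_minimalDiscriminant_5015b1]; decide⟩

/-! ## §2 The rung at `(5015b1, 5)`, `d_K = −23` -/

/-- **The slice at the row `(5015b1, 5, d_K = −23)` from the published facts and the TWO ATTESTED CERTIFICATES** —
the body of `ShimuraKolyvaginOrderBoundInertFromFive` at `W := 5015b1`, `p := 5` (literally, planner g26's registered
style) with the ONE extra binder `NumberField.discr K = −23` right after `IsImaginaryQuadratic K`, CONCLUDED from
`hKo`, `hB` (Kolyvagin 1990 ∕ McCallum 1991), `hSk` (Skinner 2016 Thm. C), `hGZK` (GZK), `hmod` (modularity) and: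
(i) rest-p2's kit j255090 — a field `K₁` with `d_{K₁} = −179` (Heegner for `5015`), a Heegner point `y₁ ∈ E(K₁)` of
infinite order with `5 ∤ [E(K₁):ℤy₁]`; (ii) this seat's kit j255672 — `L(E^{(−23)},1) ≠ 0` and
`ord₅ (L(Wd,1)/Ω_{Wd}) ≤ 0` (`= ord₅ 8 = 0`) on every globally minimal model `Wd` of `E^{(−23)}`. Mechanism:
`shimuraKolyvaginOrderBoundInert_at_of_certificates` (`Ш(E/K)[5^∞] = 0`); the curve-level binders (`5 ≤ 5`, `ρ̄₅`
onto, the inert ∕ split clauses, `S ∋ 5`) arrive inside the conclusion and the "no Tamagawa loss" data are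
kernel-decided (`mult_and_not_dvd_of_prime_dvd_5015`); the datum `X, P₀, Dt, P, degS` and the display are carried,
unused. CONDITIONAL on every binder; ONE pair; nothing booked; a T3 witness only modulo the attestations.
[cite: Kim2022HigherGZ, §2.1 and Thm. 4.3] [cite: Skinner2016PacificMC, Thm. C (§1)]
[cite: McCallumLMS1991, §1 Theorem (Kolyvagin), p. 296] [cite: JetchevSkinnerWan2017, §7.4.1 (p. 30)]
[cite: Cremona1997, Table 1 (curve 5015b1)] -/
theorem rung_inert_5015b1_of_cert
    [((⟨0, 0, 1, -248, 1503⟩ : WeierstrassCurve ℤ).baseChange ℚ).IsElliptic] [((⟨0, 0, 1, -248, 1503⟩ : WeierstrassCurve ℤ).baseChange ℚ).IsGloballyMinimal] [Fact (Nat.Prime 5)]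
    -- published named facts (conjuncts 2, 3, 4, 6, 7 of the route's `PublishedInputsFive`)
    (hKo : ∀ (N : ℕ) [NeZero N] (W : WeierstrassCurve ℚ) (K : Type) [Field K] [NumberField K],
      kolyvagin N W K)
    (hB : ∀ (N : ℕ) [NeZero N] (W : WeierstrassCurve ℚ) (K : Type) [Field K] [NumberField K],
      Kolyvagin1990_padicValNat_card_sha_le N W K)
    (hSk : Skinner2016.thmC_padicValRat_bsd_rank_zero)
    (hGZK : rank_eq_analyticRank_of_analyticRank_le_one) (hmod : hasEntireLFunction_rat)
    -- CERTIFICATE (i) (attested, rest-p2 kit j255090): K₁ = ℚ(√−179), y₁ = −2·(9,0), 5 ∤ [E(K₁) : ℤ y₁]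
    (K₁ : Type) [Field K₁] [NumberField K₁] (hK₁ : IsImaginaryQuadratic K₁) (_hd₁ : NumberField.discr K₁ = -179)
    (hH₁ : SatisfiesHeegnerHypothesis 5015 K₁) (y₁ : (((⟨0, 0, 1, -248, 1503⟩ : WeierstrassCurve ℤ).baseChange ℚ).baseChange K₁).toAffine.Point)
    (hy₁ : IsHeegnerPoint 5015 ((⟨0, 0, 1, -248, 1503⟩ : WeierstrassCurve ℤ).baseChange ℚ) K₁ y₁)
    (hy₁nt : ¬ IsOfFinAddOrder y₁) (hI₁ : ¬ 5 ∣ (AddSubgroup.zmultiples y₁).index)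
    -- CERTIFICATE (ii) (attested, kit j255672): the twist by −23 has analytic rank 0 and L/Ω = 8, a 5-adic unit
    (hLt : (((⟨0, 0, 1, -248, 1503⟩ : WeierstrassCurve ℤ).baseChange ℚ).quadraticTwist ((-23 : ℤ) : ℚ)).entireLFunction 1 ≠ 0)
    (hLval : ∀ (Wd : WeierstrassCurve ℚ) [Wd.IsElliptic] [Wd.IsGloballyMinimal] (Cd : VariableChange ℚ),
      Cd • ((⟨0, 0, 1, -248, 1503⟩ : WeierstrassCurve ℤ).baseChange ℚ).quadraticTwist ((-23 : ℤ) : ℚ) = Wd →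
      ∀ q : ℚ, Wd.entireLFunction 1 / (Wd.realPeriodRat : ℂ) = (q : ℂ) → padicValRat 5 q ≤ 0) :
    ∀ (N : ℕ) [NeZero N] (K : Type) [Field K] [NumberField K] (S : Finset ℕ) (Dt : Literature.NumberTheory.EllipticCurves.ModularForms.ModularParametrizationData ((⟨0, 0, 1, -248, 1503⟩ : WeierstrassCurve ℤ).baseChange ℚ) N) (X : Literature.NumberTheory.Automorphic.ShimuraCurveData (∏ q ∈ S, q) (N / ∏ q ∈ S, q)) (W' : WeierstrassCurve ℚ) [W'.IsElliptic] (P₀ : Literature.NumberTheory.Automorphic.ShimuraParametrizationData X W'), ((⟨0, 0, 1, -248, 1503⟩ : WeierstrassCurve ℤ).baseChange ℚ).conductorNorm ℤ = N → 5 ≤ 5 → ((⟨0, 0, 1, -248, 1503⟩ : WeierstrassCurve ℤ).baseChange ℚ).HasSurjectiveModNGaloisRep 5 → Literature.NumberTheory.EllipticCurves.IsImaginaryQuadratic K → NumberField.discr K = -23 → Even S.card → (∀ ℓ ∈ S, ℓ.Prime ∧ ℓ ∣ N ∧ ¬ ℓ ^ 2 ∣ N ∧ ((Ideal.span {(ℓ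 : ℤ)}).primesOver (NumberField.RingOfIntegers K)).ncard = 1 ∧ ¬ (ℓ : ℤ) ∣ NumberField.discr K) → (∀ ℓ : ℕ, ℓ.Prime → ℓ ∣ N → ℓ ∉ S → ((Ideal.span {(ℓ : ℤ)}).primesOver (NumberField.RingOfIntegers K)).ncard = 2) → 5 ∈ S → ¬ (5 : ℤ) ∣ Dt.c → P₀.IsMinimalFor ((⟨0, 0, 1, -248, 1503⟩ : WeierstrassCurve ℤ).baseChange ℚ) → ∀ (P : (((⟨0, 0, 1, -248, 1503⟩ : WeierstrassCurve ℤ).baseChange ℚ).baseChange K).toAffine.Point) (degS : ℕ), 0 < degS → padicValNat 5 degS = padicValNat 5 P₀.deg → Literature.NumberTheory.EllipticCurves.LDerivEK ((⟨0, 0, 1, -248, 1503⟩ : WeierstrassCurve ℤ).baseChange ℚ) K = 8 * (Real.pi : ℂ) ^ 2 * Literature.NumberTheory.EllipticCurves.ModularForms.peterssonProduct (CongruenceSubgroup.Gamma0 N) 2 Dt.f Dt.f / ((((NumberField.Units.torsionOrder K : ℝ) / 2) ^ 2 * √|(NumberField.discr K : ℝ)| : ℝ) : ℂ) * ((P.canonicalHeight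 : ℂ) / (degS : ℂ)) → ¬ IsOfFinAddOrder P → Nat.card (AddCommGroup.primaryComponent (((⟨0, 0, 1, -248, 1503⟩ : WeierstrassCurve ℤ).baseChange ℚ).baseChange K).sha 5) ≤ 5 ^ (2 * padicValNat 5 (AddSubgroup.zmultiples P).index) := by
  intro N _ K _ _ S Dt X W' _ P₀ hN _ hsurj hK hd _ hin hsp hpS _ _ P degS _ _ _ _
  have hN5015 : N = 5015 := by rw [← hN, conductorNorm_5015b1]
  haveI : NeZero (5015 : ℕ) := ⟨by norm_num⟩
  have hd' : ((-23 : ℤ) : ℚ) = (NumberField.discr K : ℚ) := by rw [hd]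
  refine shimuraKolyvaginOrderBoundInert_at_of_certificates hSk hGZK hmod _ 5 le_rfl hsurj mult_five_5015b1
    ram_five_5015b1 hN K hK S hin hsp hpS ?_ ?_ ?_ ?_ ?_ ?_ P
  · -- every `ℓ ∈ S` divides `N = 5015`: multiplicative
    intro ℓ hℓ
    obtain ⟨hℓp, hℓN, -⟩ := hin ℓ hℓ
    obtain ⟨hF, hm, -⟩ := mult_and_not_dvd_of_prime_dvd_5015 ℓ hℓp (hN5015 ▸ hℓN)
    exact ⟨hF, hm⟩
  · -- no Tamagawa loss inside `S`
    intro ℓ hℓ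
    obtain ⟨hℓp, hℓN, -⟩ := hin ℓ hℓ
    obtain ⟨-, -, hv⟩ := mult_and_not_dvd_of_prime_dvd_5015 ℓ hℓp (hN5015 ▸ hℓN)
    exact hv
  · -- no Tamagawa loss at the split multiplicative primes outside `S`
    intro ℓ _ _ hs
    have hm := hs.hasMultiplicativeReductionAtPrime
    have hℓN : ℓ ∣ ((⟨0, 0, 1, -248, 1503⟩ : WeierstrassCurve ℤ).baseChange ℚ).conductorNorm ℤ :=
      (WeierstrassCurve.dvd_conductorNorm_iff_not_hasGoodReductionAtPrime _ ℓ).mpr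
        (WeierstrassCurve.HasMultiplicativeReduction.not_hasGoodReduction (R := ℤ_[ℓ]) hm)
    rw [conductorNorm_5015b1] at hℓN
    obtain ⟨-, -, hv⟩ := mult_and_not_dvd_of_prime_dvd_5015 ℓ (Fact.out) hℓN
    exact hv
  · -- certificate (i): Ш(E/ℚ)[5] = 0 from Kolyvagin's classical index certificate at ℚ(√−179)
    exact noPTorsion_sha_of_kolyvaginIndexCertificate hKo hB _ 5 (by decide) hsurj 5015 K₁ hK₁ hH₁ hy₁ hy₁nt hI₁
  · -- certificate (ii): the twist's central value
    rw [← hd']; exact hLt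
  · intro Wd _ _ Cd hCd q hq
    rw [← hd'] at hCd
    exact hLval Wd Cd hCd q hq

/-! ## §3 The registered-shape rung (the signature offered for `stub_rung_inert_5015b1`) -/

/-- **`rung_inert_5015b1_of_items` — the BC5 CERTIFICATE-ROW RUNG of crux `ShimuraKolyvaginOrderBoundInertFromFive`
(item 19718) in EXACTLY the shape offered to planner g26 as the registered stub `stub_rung_inert_5015b1`** (his 16:34:35Z (c): "the moment your DELIVERED line
carries the exact rung signature … I RE-REGISTER 19718 with that rung"): leading binders = the route's support item
`PublishedInputsFive` BY NAME (item 19066; conjuncts `kolyvagin`, `Kolyvagin1990_padicValNat_card_sha_le`, Skinner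
2016 Thm. C, GZK, `hasEntireLFunction_rat` are used) + the two ATTESTED certificate packages (kit j255090: `K₁`,
`d_{K₁} = −179`, Heegner point `y₁`, `5 ∤ [E(K₁):ℤy₁]`; kit j255672: `L(E^{(−23)},1) ≠ 0`, `ord₅ L(Wd,1)/Ω_{Wd} ≤ 0` on
the minimal models of the twist) + the slice body at `W := 5015b1`, `p := 5` with `NumberField.discr K = −23`. A rung
with NO fact ∕ certificate binders cannot be closed by anyone (the facts are Literature `def`s without `_holds`,
the certificates are computations); this is the honest by-name form (shim-p2's v5 pattern for 19616). CONDITIONAL;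
ONE pair; nothing booked. [cite: Kim2022HigherGZ, §2.1 and Thm. 4.3] [cite: Skinner2016PacificMC, Thm. C (§1)]
[cite: McCallumLMS1991, §1 Theorem (Kolyvagin), p. 296] [cite: Cremona1997, Table 1 (curve 5015b1)] -/
theorem rung_inert_5015b1_of_items
    [((⟨0, 0, 1, -248, 1503⟩ : WeierstrassCurve ℤ).baseChange ℚ).IsElliptic] [((⟨0, 0, 1, -248, 1503⟩ : WeierstrassCurve ℤ).baseChange ℚ).IsGloballyMinimal] [Fact (Nat.Prime 5)] :
    Summit.BirchSwinnertonDyer.BirchSwinnertonDyer.Theses.ErratumRoadFive.PublishedInputsFive →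
    ∀ (K₁ : Type) [Field K₁] [NumberField K₁], Literature.NumberTheory.EllipticCurves.IsImaginaryQuadratic K₁ → NumberField.discr K₁ = -179 → Literature.NumberTheory.EllipticCurves.SatisfiesHeegnerHypothesis 5015 K₁ → ∀ (y₁ : (((⟨0, 0, 1, -248, 1503⟩ : WeierstrassCurve ℤ).baseChange ℚ).baseChange K₁).toAffine.Point), Literature.NumberTheory.EllipticCurves.IsHeegnerPoint 5015 ((⟨0, 0, 1, -248, 1503⟩ : WeierstrassCurve ℤ).baseChange ℚ) K₁ y₁ → ¬ IsOfFinAddOrder y₁ → ¬ 5 ∣ (AddSubgroup.zmultiples y₁).index →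
    (((⟨0, 0, 1, -248, 1503⟩ : WeierstrassCurve ℤ).baseChange ℚ).quadraticTwist ((-23 : ℤ) : ℚ)).entireLFunction 1 ≠ 0 →
    (∀ (Wd : WeierstrassCurve ℚ) [Wd.IsElliptic] [Wd.IsGloballyMinimal] (Cd : WeierstrassCurve.VariableChange ℚ), Cd • ((⟨0, 0, 1, -248, 1503⟩ : WeierstrassCurve ℤ).baseChange ℚ).quadraticTwist ((-23 : ℤ) : ℚ) = Wd → ∀ q : ℚ, Wd.entireLFunction 1 / (Wd.realPeriodRat : ℂ) = (q : ℂ) → padicValRat 5 q ≤ 0) →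
    ∀ (N : ℕ) [NeZero N] (K : Type) [Field K] [NumberField K] (S : Finset ℕ) (Dt : Literature.NumberTheory.EllipticCurves.ModularForms.ModularParametrizationData ((⟨0, 0, 1, -248, 1503⟩ : WeierstrassCurve ℤ).baseChange ℚ) N) (X : Literature.NumberTheory.Automorphic.ShimuraCurveData (∏ q ∈ S, q) (N / ∏ q ∈ S, q)) (W' : WeierstrassCurve ℚ) [W'.IsElliptic] (P₀ : Literature.NumberTheory.Automorphic.ShimuraParametrizationData X W'), ((⟨0, 0, 1, -248, 1503⟩ : WeierstrassCurve ℤ).baseChange ℚ).conductorNorm ℤ = N → 5 ≤ 5 → ((⟨0, 0, 1, -248, 1503⟩ : WeierstrassCurve ℤ).baseChange ℚ).HasSurjectiveModNGaloisRep 5 → Literature.NumberTheory.EllipticCurves.IsImaginaryQuadratic K → NumberField.discr K = -23 → Even S.card → (∀ ℓ ∈ S, ℓ.Prime ∧ ℓ ∣ N ∧ ¬ ℓ ^ 2 ∣ N ∧ ((Ideal.span {(ℓ : ℤ)}).primesOver (NumberField.RingOfIntegers K)).ncard = 1 ∧ ¬ (ℓ : ℤ) ∣ NumberField.discr K) → (∀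 ℓ : ℕ, ℓ.Prime → ℓ ∣ N → ℓ ∉ S → ((Ideal.span {(ℓ : ℤ)}).primesOver (NumberField.RingOfIntegers K)).ncard = 2) → 5 ∈ S → ¬ (5 : ℤ) ∣ Dt.c → P₀.IsMinimalFor ((⟨0, 0, 1, -248, 1503⟩ : WeierstrassCurve ℤ).baseChange ℚ) → ∀ (P : (((⟨0, 0, 1, -248, 1503⟩ : WeierstrassCurve ℤ).baseChange ℚ).baseChange K).toAffine.Point) (degS : ℕ), 0 < degS → padicValNat 5 degS = padicValNat 5 P₀.deg → Literature.NumberTheory.EllipticCurves.LDerivEK ((⟨0, 0, 1, -248, 1503⟩ : WeierstrassCurve ℤ).baseChange ℚ) K = 8 * (Real.pi : ℂ) ^ 2 * Literature.NumberTheory.EllipticCurves.ModularForms.peterssonProduct (CongruenceSubgroup.Gamma0 N) 2 Dt.f Dt.f / ((((NumberField.Units.torsionOrder K : ℝ) / 2) ^ 2 * √|(NumberField.discr K : ℝ)| : ℝ) : ℂ) * ((P.canonicalHeight : ℂ) / (degS : ℂ)) → ¬ IsOfFinAddOrder P → Nat.card (AddCommGroup.primaryComponent (((⟨0, 0, 1,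 -248, 1503⟩ : WeierstrassCurve ℤ).baseChange ℚ).baseChange K).sha 5) ≤ 5 ^ (2 * padicValNat 5 (AddSubgroup.zmultiples P).index) := by
  intro hF K₁ _ _ hK₁ hd₁ hH₁ y₁ hy₁ hy₁nt hI₁ hLt hLval
  obtain ⟨-, hKo, hB, hSk, -, hGZK, hmod, -, -, -, -, -, -, -, -⟩ := hF
  exact rung_inert_5015b1_of_cert hKo hB hSk hGZK hmod K₁ hK₁ hd₁ hH₁ y₁ hy₁ hy₁nt hI₁ hLt hLval

/-! ## §4 The registered BC5 rung of item 19718, BY NAME (skeleton v2, planner g26 17:06:51Z) -/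

/-- **`stub_rung_inert_5015b1` — the REGISTERED plan-only BC5 rung of crux `ShimuraKolyvaginOrderBoundInertFromFive`
(item stmt-BirchSwinnertonDyer-19718; skeleton v2 `Cruxes/ShimuraKolyvaginOrderBoundInertFromFive/Lines/birth.lean`, sha16
df9d5864b1b31f6b, registered by planner g26 2026-08-26T17:06:51Z), its signature VERBATIM, closed by `rung_inert_5015b1_of_items`:**
the inert slice at the row `(5015b1, 5, d_K = −23)` (`S = {5, 17}` inert, `59` split), GIVEN the route's `PublishedInputsFive` and the two
ATTESTED certificates (rest-p2 kit j255090: classical Kolyvagin index certificate at `ℚ(√−179)`; kit j255672: `L(E^{(−23)},1) ≠ 0`,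
`ord₅ L/Ω = 0` on the twist's minimal model) — `Ш(E/ℚ(√−23))[5^∞] = 0`. A rung is ONE pair and closes nothing of the crux proper
(the Kolyvagin system on `X_{59,85}` is not exercised); CONDITIONAL on every binder; nothing is booked; BSD is not proved by any of this.
[cite: Kim2022HigherGZ, §2.1 and Thm. 4.3] [cite: Skinner2016PacificMC, Thm. C (§1)] [cite: McCallumLMS1991, §1 Theorem (Kolyvagin), p. 296]
[cite: JetchevSkinnerWan2017, §7.4.1 (p. 30)] [cite: Cremona1997, Table 1 (curve 5015b1)] -/
theorem stub_rung_inert_5015b1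
    [((⟨0, 0, 1, -248, 1503⟩ : WeierstrassCurve ℤ).baseChange ℚ).IsElliptic] [((⟨0, 0, 1, -248, 1503⟩ : WeierstrassCurve ℤ).baseChange ℚ).IsGloballyMinimal] [Fact (Nat.Prime 5)] :
    Summit.BirchSwinnertonDyer.BirchSwinnertonDyer.Theses.ErratumRoadFive.PublishedInputsFive →
    ∀ (K₁ : Type) [Field K₁] [NumberField K₁], Literature.NumberTheory.EllipticCurves.IsImaginaryQuadratic K₁ → NumberField.discr K₁ = -179 → Literature.NumberTheory.EllipticCurves.SatisfiesHeegnerHypothesis 5015 K₁ → ∀ (y₁ : (((⟨0, 0, 1, -248, 1503⟩ : WeierstrassCurve ℤ).baseChange ℚ).baseChange K₁).toAffine.Point), Literature.NumberTheory.EllipticCurves.IsHeegnerPoint 5015 ((⟨0, 0, 1, -248, 1503⟩ : WeierstrassCurve ℤ).baseChange ℚ) K₁ y₁ → ¬ IsOfFinAddOrder y₁ → ¬ 5 ∣ (AddSubgroup.zmultiples y₁).index →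
    (((⟨0, 0, 1, -248, 1503⟩ : WeierstrassCurve ℤ).baseChange ℚ).quadraticTwist ((-23 : ℤ) : ℚ)).entireLFunction 1 ≠ 0 →
    (∀ (Wd : WeierstrassCurve ℚ) [Wd.IsElliptic] [Wd.IsGloballyMinimal] (Cd : WeierstrassCurve.VariableChange ℚ), Cd • ((⟨0, 0, 1, -248, 1503⟩ : WeierstrassCurve ℤ).baseChange ℚ).quadraticTwist ((-23 : ℤ) : ℚ) = Wd → ∀ q : ℚ, Wd.entireLFunction 1 / (Wd.realPeriodRat : ℂ) = (q : ℂ) → padicValRat 5 q ≤ 0) →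
    ∀ (N : ℕ) [NeZero N] (K : Type) [Field K] [NumberField K] (S : Finset ℕ) (Dt : Literature.NumberTheory.EllipticCurves.ModularForms.ModularParametrizationData ((⟨0, 0, 1, -248, 1503⟩ : WeierstrassCurve ℤ).baseChange ℚ) N) (X : Literature.NumberTheory.Automorphic.ShimuraCurveData (∏ q ∈ S, q) (N / ∏ q ∈ S, q)) (W' : WeierstrassCurve ℚ) [W'.IsElliptic] (P₀ : Literature.NumberTheory.Automorphic.ShimuraParametrizationData X W'), ((⟨0, 0, 1, -248, 1503⟩ : WeierstrassCurve ℤ).baseChange ℚ).conductorNorm ℤ = N → 5 ≤ 5 → ((⟨0, 0, 1, -248, 1503⟩ : WeierstrassCurve ℤ).baseChange ℚ).HasSurjectiveModNGaloisRep 5 → Literature.NumberTheory.EllipticCurves.IsImaginaryQuadratic K → NumberField.discr K = -23 → Even S.card → (∀ ℓ ∈ S, ℓ.Prime ∧ ℓ ∣ N ∧ ¬ ℓ ^ 2 ∣ N ∧ ((Ideal.span {(ℓ : ℤ)}).primesOver (NumberField.RingOfIntegers K)).ncard = 1 ∧ ¬ (ℓ : ℤ) ∣ NumberField.discr K) → (∀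 ℓ : ℕ, ℓ.Prime → ℓ ∣ N → ℓ ∉ S → ((Ideal.span {(ℓ : ℤ)}).primesOver (NumberField.RingOfIntegers K)).ncard = 2) → 5 ∈ S → ¬ (5 : ℤ) ∣ Dt.c → P₀.IsMinimalFor ((⟨0, 0, 1, -248, 1503⟩ : WeierstrassCurve ℤ).baseChange ℚ) → ∀ (P : (((⟨0, 0, 1, -248, 1503⟩ : WeierstrassCurve ℤ).baseChange ℚ).baseChange K).toAffine.Point) (degS : ℕ), 0 < degS → padicValNat 5 degS = padicValNat 5 P₀.deg → Literature.NumberTheory.EllipticCurves.LDerivEK ((⟨0, 0, 1, -248, 1503⟩ : WeierstrassCurve ℤ).baseChange ℚ) K = 8 * (Real.pi : ℂ) ^ 2 * Literature.NumberTheory.EllipticCurves.ModularForms.peterssonProduct (CongruenceSubgroup.Gamma0 N) 2 Dt.f Dt.f / ((((NumberField.Units.torsionOrder K : ℝ) / 2) ^ 2 * √|(NumberField.discr K : ℝ)| : ℝ) : ℂ) * ((P.canonicalHeight : ℂ) / (degS : ℂ)) → ¬ IsOfFinAddOrder P → Nat.card (AddCommGroup.primaryComponent (((⟨0, 0, 1,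 -248, 1503⟩ : WeierstrassCurve ℤ).baseChange ℚ).baseChange K).sha 5) ≤ 5 ^ (2 * padicValNat 5 (AddSubgroup.zmultiples P).index) :=
  rung_inert_5015b1_of_items

end Summit.BirchSwinnertonDyer.BirchSwinnertonDyer.Theorems

end
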